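import Literature.MathematicalPhysics.QuantumFieldTheory.Balaban1983to89.B13Term214Centred

/-!
# `Balaban1983to89.B13Term214CentredPieces` — T. Bałaban, *Renormalization group approach to lattice gauge field theories. II.
Cluster expansions*, Commun. Math. Phys. **116** (1988) 1–22 [Balaban1988RG2Cluster], pp. 15–17, with [Balaban1987RG1]
(2.10)–(2.13) pp. 266–268: the three elementary complements around the CENTRED chain of `B13Term214Centred` ∕
`B13Bound226Centred` that turn the per-term centred letter `‖(2.14)_b(χ, 𝐕) − (2.14)_b(χ, 𝐕₀)‖ ≤ s²·W` into the shape of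
node N22's (S-vertex-T′) `‖member(b) − V‖ ≤ s²·(E₁ + E₂)·W` with a COUPLING-BLIND centre `V`: (i) the printed operators are
linear in a constant and the last line is homogeneous in its characteristic functions, so the box complement `1 − χχᶜ` and the
large-field surplus are (2.22)-type characteristic functions carrying a SMALL CONSTANT in front («both tails are (2.22)» — no new
estimate); (ii) a function holomorphic on the ball `|b − 1| < ρ ≤ 1` and invariant under REAL dilations is constant, so the
box-free background-valued member of the window-dilated family is `b`-free («the centre is b-free» — no Gaussian generating
function); (iii) the three-piece assembly and the F-GENERIC centred (2.23)∕(2.26) with every integrability side condition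
discharged from the letters

statement-level skeleton of published theorems with citation tags; proofs where landed; nothing here is a claim about the
Yang–Mills mass gap

PDF held: `paper:balaban1988-cmp116-rg-ii-cluster` (journal page = PDF page + 0), pp. 15–17 (quoted in full in `B13Term214`,
`B13FirstEstimate215`, `B13Replacement223`, `B13Bound226Primitive`); `paper:balaban1987-cmp109-rg-i` pp. 266–268.

CITATION HEADER.  [II] p. 16 (2.22): *"χ_{k,Y₀} χ^c_{k,P} ≤ exp(−½γ₂ r_P²|P| + ½γ₂ q_P(B))"* (shape; quoted in `B13Integral223`);
p. 15 (2.14)–(2.15) and p. 17 (2.23)–(2.26) as quoted in `B13Term214` ∕ `B13Replacement223`; [I] p. 266–267 (2.10)–(2.13) (the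
small-field characteristic functions are norms of `s·B′`, the action is expanded around the critical background).  NOT PRINTED:
the decomposition «centred piece + box tail + b-free centre»; what is recorded is that each piece is priced by print's own chain.

PROVENANCE.  §1–§5 are a PORT WITH PROVENANCE of the memo-only lens seat's sketch
`run/shared/lean/pub/pub-ymgap/ym-lens-BalabanUVNodes-transfer/lean/LensTransferSketch13.lean` (sha16 88f43d97958ff640, namespace
`YMLens.Transfer13`, seat `ym-lens-BalabanUVNodes-transfer` g13, Cards T23∕T24∕T25 + rider P⁵ of `LENS-transfer.md` §19; *«the
lens files nothing … n10-c owns the engine»*, bus `run/shared/lean/pub/pub-ymgap/INBOX.md` l.18879∕18889): statements and proofs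
are the lens's, re-homed under `Literature` so that tree files can import them, each docstring saying so; the duplicate of a tree
lemma (`re_sq_le_norm_sq`, = `Literature.Barriers.FinalStateConjecture.KleinGordonSuperradiantInstabilityProofs.re_sq_le_norm_sq`)
is NOT re-declared (inlined where used).  Cell `pub-ymgap`, seat `pub-ymgap-dag-n10-c` (g6), node N10 [B13]; consumers: node
N22's (S-vertex-T′) (`Summits/…/BalabanUVNodesN22W1RelCentredSectorOfWindowDilated` J1, two-step centre), the unseated N09
successor (assembly), this seat's `B13Bound226BoxTail` (the torus-level tails).

WHAT IS HERE (no definition).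
* §1 LINEARITY IN A CONSTANT, no hypothesis (`cauchyD_const_mul`, `TopC_const_mul`, `term214_const_mul`, `cgaussInt_const_mul`,
  `cgaussMean_const_mul`, `integrand214_const_mul`, `core214_const_mul`) and HOMOGENEITY of the printed last line in `χ`
  (`F214_chi_const_mul`), `F214(χ, χᶜ, V) − F214(1, 1, V) = −F214(1 − χχᶜ, 1, V)` (`F214_sub_F214_one`), `F214_const_dilate`.
* §2 «BOTH TAILS ARE (2.22)» (lens T24): `one_sub_box_le_gauss` (`1 − χ ≤ e^{−½κR²}·e^{½κ⟨B,B⟩}` under the box law `χ = 1` on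
  `⟨B,B⟩ < R²`), `one_sub_box_h222` (the capstone's `h222` shape for the rescaled complement), `one_sub_box_rescaled_nonneg`,
  `measurable_one_sub_box_rescaled`, `boxTail_rate` (`e^{−½κ(p∕s)²} ≤ s²·2∕(eκp²)`), `h222_rate_split` (large-field surplus).
* §3 «THE BOX-FREE CENTRE IS b-FREE» (lens T25): `eq_of_radial_invariant` (holomorphic on `ball 1 ρ`, `ρ ≤ 1`, invariant under
  real dilations ⇒ constant — `b·f′(b) = 0`), `core214_windowDilated_const_eq`, `term214_windowDilated_const_eq` (radial
  invariance = `B13Term214WindowDilated.core214∕term214_dilate_family`; holomorphy in `b` a hypothesis, = module 41 §4).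
* §4 THE ASSEMBLY SHAPE (lens T23): `centred_three_pieces`, `centred_sum`, `consumer_shape` (`s = Re u`, `(Re u)² ≤ |u|²`).
* §5 THE F-GENERIC CENTRED (2.23)∕(2.26) (lens rider P⁵ §E): `norm_core214_centred_le_223_of_letters`,
  `norm_core214_centred_le_226_of_letters`, `norm_core214_boxTail_le_223_of_letters` — `B13Term214Centred.norm_core214_sub_le_215_centred`
  ∘ `B13Replacement223.replaced_le_integral223`, the six linearity conditions by `integrable_inner∕outer_of_letters`, the two
  (2.15) ones by `integrable_hg215_gauss` ∕ `integrable_hX215_gauss`: NO integrability hypothesis survives.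
HONEST SCOPE.  Elementary; no estimate new in kind (the only Gaussian inequality is print's (2.15), inside the cited lemma).  The
SIZES of the small factors (`p(s)`, `κ`, the letters `T_χ`, `T_P`), the box laws and the field-constancy of the centre's potentials
are the PRODUCER's data about the datum ([I] (2.9)–(2.13)) — hypotheses here.  Nothing of Bałaban's kernels is constructed;
N10∕N22∕N09 NOT discharged.  No `sorry`, no definition, no new named fact (D-0026).
-/

noncomputable section

namespace Literature.MathematicalPhysics.QuantumFieldTheory.Balaban1983to89.B13Term214CentredPieces

open Matrix MeasureTheory Finset Complex Metric Set
open scoped Real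
open B13GaugeDevices (gaussWeight gaussMean)
open B13Term214 (cquad cgaussWeight cgaussInt cgaussNorm cgaussMean integrand214 core214 F214 cauchyD TopC term214)
open B13Term214WindowDilated (core214_dilate_family term214_dilate_family)
open B13Integral223 (integral223 integral223_le posDef_inv_sub_smul)
open B13FirstEstimate215 (norm_F214_le_printed)
open B13Replacement223 (replaced_le_integral223 integrable_hg215_gauss integrable_hX215_gauss)
open B13Core214Holomorphic (measurable_F214)
open B13Term214Centred (norm_core214_sub_le_215_centred integrable_inner_of_letters integrable_outer_of_letters)

variable {Λ : Type} [Fintype Λ] [DecidableEq Λ]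

/-! ## §1. Linearity in a constant (no hypothesis) and homogeneity of the printed last line in `χ` (lens Sketch13 §P) -/

section Plumbing

variable {ι : Type*} [DecidableEq ι]

/-- `cauchyD` is linear in a constant factor (no hypothesis: the circle integral of `a • f` is `a •` the integral; lens Sketch13 §P). [cite: Balaban1988RG2Cluster, (2.14) p.15] (elementary API for (2.14)) -/
theorem cauchyD_const_mul (r : ℝ) (c : ℂ) (f : ℂ → ℂ) (s : ℂ) :
    cauchyD r (fun z => c * f z) s = c * cauchyD r f s := by
  unfold cauchyD
  have h : (fun σ : ℂ => (1 / (σ - s) ^ 2) • (c * f σ)) = fun σ => c • ((1 / (σ - s) ^ 2) • f σ) := by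
    funext σ; simp only [smul_eq_mul]; ring
  rw [h, circleIntegral.integral_smul, smul_eq_mul, smul_eq_mul, smul_eq_mul]
  ring

/-- The printed operator `Π ∫₀¹ds (1/2πi)∮dσ/(σ−s)²` is linear in a constant factor (no hypothesis; lens Sketch13 §P). [cite: Balaban1988RG2Cluster, (2.14) p.15] (elementary API) -/
theorem TopC_const_mul (r : ℝ) (c : ℂ) :
    ∀ (l : List ι) (Φ : (ι → ℂ) → ℂ) (p : ι → ℂ), TopC r l (fun q => c * Φ q) p = c * TopC r l Φ p
  | [], _, _ => by simp [TopC]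
  | i :: l, Φ, p => by
    have ih : (fun z : ℂ => TopC r l (fun q => c * Φ q) (Function.update p i z))
        = fun z => c * TopC r l Φ (Function.update p i z) :=
      funext fun z => TopC_const_mul r c l Φ _
    simp only [TopC, ih, cauchyD_const_mul, intervalIntegral.integral_const_mul]

/-- **The (2.14) term is linear in a constant factor of its `X`-integral** (no hypothesis; lens Sketch13 §P). [cite: Balaban1988RG2Cluster, (2.14) p.15] (elementary API) -/
theorem term214_const_mul {κ : Type*} [DecidableEq κ] (r : ℝ) (lZ : List ι) (lD : List κ) (c : ℂ)
    (Ψ : (ι → ℂ) → (κ → ℂ) → ℂ) (σ₀ : ι → ℂ) (τ₀ : κ → ℂ) :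
    term214 r lZ lD (fun σ τ => c * Ψ σ τ) σ₀ τ₀ = c * term214 r lZ lD Ψ σ₀ τ₀ := by
  simp only [term214]
  have h : (fun σ : ι → ℂ => TopC r lD (fun τ => c * Ψ σ τ) τ₀) = fun σ => c * TopC r lD (fun τ => Ψ σ τ) τ₀ :=
    funext fun σ => TopC_const_mul r c lD _ τ₀
  rw [h, TopC_const_mul]

end Plumbing

omit [DecidableEq Λ] in
/-- The complex Gaussian integral is linear in a constant factor (no hypothesis; lens Sketch13 §P). [cite: Balaban1988RG2Cluster, (2.14) p.15] (elementary API for (2.14)) -/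
theorem cgaussInt_const_mul (A : Matrix Λ Λ ℂ) (c : ℂ) (Ψ : (Λ → ℝ) → ℂ) :
    cgaussInt A (fun v => c * Ψ v) = c * cgaussInt A Ψ := by
  simp only [cgaussInt]
  rw [← integral_const_mul]
  exact integral_congr_ae (Filter.Eventually.of_forall fun v => by simp only; ring)

omit [DecidableEq Λ] in
/-- The complex Gaussian mean is linear in a constant factor (no hypothesis; lens Sketch13 §P). [cite: Balaban1988RG2Cluster, (2.14) p.15] (elementary API for (2.14)) -/
theorem cgaussMean_const_mul (A : Matrix Λ Λ ℂ) (c : ℂ) (Ψ : (Λ → ℝ) → ℂ) :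
    cgaussMean A (fun v => c * Ψ v) = c * cgaussMean A Ψ := by
  simp only [cgaussMean, cgaussInt_const_mul]; ring

variable {C₀ : Type} [Fintype C₀]

omit [Fintype C₀] in
/-- Lines 2–3 of (2.14) are linear in a constant factor of the last line (no hypothesis; lens Sketch13 §P). [cite: Balaban1988RG2Cluster, (2.14) p.15] (elementary API) -/
theorem integrand214_const_mul (A : Matrix Λ Λ ℂ) (Γ : (Λ ⊕ C₀ → ℝ) → (Λ → ℂ)) (c : ℂ) (F : (Λ → ℝ) → ℂ)
    (X : Λ ⊕ C₀ → ℝ) : integrand214 A Γ (fun B => c * F B) X = c * integrand214 A Γ F X := by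
  unfold integrand214
  have h : (fun B : Λ → ℝ => Complex.exp (-((fun i => (B i : ℂ)) ⬝ᵥ Γ X)) * (c * F B))
      = fun B => c * (Complex.exp (-((fun i => (B i : ℂ)) ⬝ᵥ Γ X)) * F B) := funext fun B => by ring
  rw [h, cgaussMean_const_mul]; ring

/-- **The `X`-integral of (2.14) is linear in a constant factor of the last line** (no hypothesis; lens Sketch13 §P). [cite: Balaban1988RG2Cluster, (2.14) p.15] (elementary API) -/
theorem core214_const_mul [DecidableEq C₀] {ι D : Type*} (A : (ι → ℂ) → Matrix Λ Λ ℂ)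
    (Γ : (ι → ℂ) → (Λ ⊕ C₀ → ℝ) → (Λ → ℂ)) (c : ℂ) (F : (D → ℂ) → (Λ → ℝ) → ℂ) (σ : ι → ℂ) (τ : D → ℂ) :
    core214 A Γ (fun τ B => c * F τ B) σ τ = c * core214 A Γ F σ τ := by
  unfold core214
  have h : (fun X => integrand214 (A σ) (Γ σ) (fun B => c * F τ B) X) = fun X => c * integrand214 (A σ) (Γ σ) (F τ) X :=
    funext fun X => integrand214_const_mul (A σ) (Γ σ) c (F τ) X
  rw [h, cgaussMean_const_mul]

section LastLine

variable {D : Type*}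

omit [Fintype Λ] [DecidableEq Λ] in
/-- **Homogeneity of the printed last line in its small-field function**: a constant factor of `χ` comes out of `F214` (lens Sketch13 §P). [cite: Balaban1988RG2Cluster, (2.14) p.15, (2.22) p.16] (elementary API) -/
theorem F214_chi_const_mul (cardP : ℕ) (c : ℝ) (χY₀ χcP : (Λ → ℝ) → ℝ) (Dfam : Finset D) (V : D → (Λ → ℝ) → ℂ)
    (τ : D → ℂ) (B : Λ → ℝ) :
    F214 cardP (fun B => c * χY₀ B) χcP Dfam V τ B = (c : ℂ) * F214 cardP χY₀ χcP Dfam V τ B := by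
  simp only [F214]; push_cast; ring

omit [Fintype Λ] [DecidableEq Λ] in
/-- **Removing the boxes is subtracting a last line of the SAME printed shape**: `F214(χ,χᶜ,V) − F214(1,1,V) =
−F214(1 − χχᶜ, 1, V)` — the box tail is a (2.14) term with characteristic function `1 − χχᶜ` (lens Sketch13 §P). [cite: Balaban1988RG2Cluster, (2.14) p.15] (elementary API) -/
theorem F214_sub_F214_one (cardP : ℕ) (χY₀ χcP : (Λ → ℝ) → ℝ) (Dfam : Finset D) (V : D → (Λ → ℝ) → ℂ) (τ : D → ℂ)
    (B : Λ → ℝ) :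
    F214 cardP χY₀ χcP Dfam V τ B - F214 cardP (fun _ => 1) (fun _ => 1) Dfam V τ B
      = -F214 cardP (fun B => 1 - χY₀ B * χcP B) (fun _ => 1) Dfam V τ B := by
  simp only [F214]; push_cast; ring

omit [Fintype Λ] [DecidableEq Λ] in
/-- A FIELD-CONSTANT last line (the centre's: boxes removed, potentials at the background `O(Y,0)`) is invariant under the
interior dilation `B ↦ r⁻¹B` — the hypothesis-free half of §3 (lens Sketch13 §P). [cite: Balaban1987RG1, (2.10)–(2.13) p.266–267] (elementary) -/
theorem F214_const_dilate (cardP : ℕ) (Dfam : Finset D) (O₀ : D → ℂ) (τ : D → ℂ) (r : ℝ) (B : Λ → ℝ) :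
    F214 cardP (fun _ => 1) (fun _ => 1) Dfam (fun Y _ => O₀ Y) τ (r⁻¹ • B)
      = F214 cardP (fun _ => 1) (fun _ => 1) Dfam (fun Y _ => O₀ Y) τ B := rfl

end LastLine

/-! ## §2. «Both tails are (2.22)» (lens Card T24, Sketch13 §T): the box complement and the large-field surplus are
characteristic functions of (2.22)-shape whose constant is the small factor -/

omit [DecidableEq Λ] in
/-- **The box complement is a (2.22)-type characteristic function with a small constant**: if `0 ≤ χ` and `χ = 1`
on the small-field ball `⟨B,B⟩ < R²`, then `1 − χ(B) ≤ e^{−½κR²}·e^{½κ⟨B,B⟩}` for every `κ ≥ 0`.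
[cite: Balaban1988RG2Cluster, (2.22) p.16] (the shape only; nothing of the paper asserted; lens Sketch13 §T) -/
theorem one_sub_box_le_gauss {χ : (Λ → ℝ) → ℝ} {R κ : ℝ} (hκ : 0 ≤ κ) (hχ0 : ∀ B, 0 ≤ χ B)
    (hbox : ∀ B, B ⬝ᵥ B < R ^ 2 → χ B = 1) (B : Λ → ℝ) :
    1 - χ B ≤ Real.exp (-(κ / 2 * R ^ 2)) * Real.exp (κ / 2 * (B ⬝ᵥ B)) := by
  by_cases h : B ⬝ᵥ B < R ^ 2
  · rw [hbox B h, sub_self]; positivity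
  · rw [not_lt] at h
    have hx : 0 ≤ -(κ / 2 * R ^ 2) + κ / 2 * (B ⬝ᵥ B) := by
      have h' := mul_le_mul_of_nonneg_left h (by linarith only [hκ] : (0 : ℝ) ≤ κ / 2)
      linarith only [h']
    have h1 : 1 - χ B ≤ 1 := by linarith only [hχ0 B]
    calc 1 - χ B ≤ 1 := h1
      _ ≤ Real.exp (-(κ / 2 * R ^ 2) + κ / 2 * (B ⬝ᵥ B)) := Real.one_le_exp hx
      _ = Real.exp (-(κ / 2 * R ^ 2)) * Real.exp (κ / 2 * (B ⬝ᵥ B)) := Real.exp_add _ _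

omit [DecidableEq Λ] in
/-- The same in the capstone's `h222` currency AFTER the small constant has been pulled out (§P): the RESCALED box
complement `(1 − χχᶜ)/e^{−½κR²}` (paired with `χᶜ := 1`) obeys (2.22) with rate `κ`, `|P|`-term absent, `q(B) = ⟨B,B⟩` (lens Sketch13 §T). [cite: Balaban1988RG2Cluster, (2.22) p.16] (shape) -/
theorem one_sub_box_h222 {χ χc : (Λ → ℝ) → ℝ} {R κ : ℝ} (hκ : 0 ≤ κ) (hχ0 : ∀ B, 0 ≤ χ B * χc B)
    (hbox : ∀ B, B ⬝ᵥ B < R ^ 2 → χ B * χc B = 1) (B : Λ → ℝ) :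
    (1 - χ B * χc B) / Real.exp (-(κ / 2 * R ^ 2)) * 1 ≤ Real.exp (κ / 2 * (B ⬝ᵥ B)) := by
  rw [mul_one, div_le_iff₀ (Real.exp_pos _)]
  exact (one_sub_box_le_gauss (χ := fun B => χ B * χc B) hκ hχ0 hbox B).trans_eq (mul_comm _ _)

omit [Fintype Λ] [DecidableEq Λ] in
/-- The rescaled box complement is still a characteristic function `≥ 0` when `χχᶜ ≤ 1` (lens Sketch13 §T). [cite: Balaban1988RG2Cluster, (2.22) p.16] (elementary API for the (2.22) data) -/
theorem one_sub_box_rescaled_nonneg {χ χc : (Λ → ℝ) → ℝ} {R κ : ℝ} (hχ1 : ∀ B, χ B * χc B ≤ 1) (B : Λ → ℝ) :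
    0 ≤ (1 - χ B * χc B) / Real.exp (-(κ / 2 * R ^ 2)) :=
  div_nonneg (sub_nonneg.2 (hχ1 B)) (Real.exp_pos _).le

omit [Fintype Λ] [DecidableEq Λ] in
/-- The rescaled box complement is measurable when `χ`, `χᶜ` are (lens Sketch13 §T). [cite: Balaban1988RG2Cluster, (2.22) p.16] (elementary API for the (2.22) data) -/
theorem measurable_one_sub_box_rescaled {χ χc : (Λ → ℝ) → ℝ} (hχm : Measurable χ) (hχcm : Measurable χc) (R κ : ℝ) :
    Measurable fun B => (1 - χ B * χc B) / Real.exp (-(κ / 2 * R ^ 2)) :=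
  (measurable_const.sub (hχm.mul hχcm)).div_const _

/-- `x·e^{−x} ≤ e^{−1}` for every real `x` (private twin of a ubiquitous `have`; cf. `MS87MUpperBound`). [folklore] -/
private theorem mul_exp_neg_le (x : ℝ) : x * Real.exp (-x) ≤ Real.exp (-1) := by
  have h : x ≤ Real.exp (x - 1) := by linarith only [Real.add_one_le_exp (x - 1)]
  calc x * Real.exp (-x) ≤ Real.exp (x - 1) * Real.exp (-x) := mul_le_mul_of_nonneg_right h (Real.exp_pos _).le
    _ = Real.exp (-1) := by rw [← Real.exp_add]; ring_nf

/-- `e^{−x} ≤ x⁻¹·e^{−1}` for `x > 0`. [folklore] -/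
private theorem exp_neg_le_inv_mul {x : ℝ} (hx : 0 < x) : Real.exp (-x) ≤ x⁻¹ * Real.exp (-1) := by
  have h := mul_exp_neg_le x
  calc Real.exp (-x) = x⁻¹ * (x * Real.exp (-x)) := by field_simp
    _ ≤ x⁻¹ * Real.exp (-1) := mul_le_mul_of_nonneg_left h (inv_nonneg.2 hx.le)

/-- **THE BOX TAIL IS `O(s²)`** (lens d7): with the small-field radius `R = p/s` in `B′`-units, the (2.22)-constant of the
box complement is `e^{−½κ(p/s)²} ≤ s²·(2/(κp²))·e^{−1}` — uniformly in `s > 0`; no `p(s) → ∞` is needed for the ORDER,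
only for the size of the letter (lens Sketch13 §T). [cite: Balaban1987RG1, (2.10)–(2.13) p.266–267] (elementary) -/
theorem boxTail_rate {κ p s : ℝ} (hκ : 0 < κ) (hp : 0 < p) (hs : 0 < s) :
    Real.exp (-(κ / 2 * (p / s) ^ 2)) ≤ s ^ 2 * (2 / (κ * p ^ 2) * Real.exp (-1)) := by
  have hx : 0 < κ / 2 * (p / s) ^ 2 := by positivity
  have hs' := hs.ne'
  have hκ' := hκ.ne'
  have hp' := hp.ne'
  refine (exp_neg_le_inv_mul hx).trans_eq ?_
  field_simp

/-- **THE LARGE-FIELD SURPLUS** (terms with `P ≠ ∅`): if `χχᶜ` obeys (2.22) with radius `r` and `|P| = n ≥ 1`, then after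
pulling out the constant `e^{−½γ₂(r² − r′²)}` it obeys (2.22) with the smaller radius `r′` — the weight keeps the rate
`γ₂r′²` per large-field box, the surplus is the small factor (choose `r² − r′² ≥ (p/s)²·κ/γ₂` and use `boxTail_rate`; lens Sketch13 §T). [cite: Balaban1988RG2Cluster, (2.22) p.16] (shape) -/
theorem h222_rate_split {x γ₂ r r' q : ℝ} {n : ℕ} (hγ₂ : 0 ≤ γ₂) (hr' : r' ^ 2 ≤ r ^ 2) (hn : 1 ≤ n)
    (hx : x ≤ Real.exp (-(γ₂ / 2 * r ^ 2 * n) + γ₂ / 2 * q)) :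
    x / Real.exp (-(γ₂ / 2 * (r ^ 2 - r' ^ 2))) ≤ Real.exp (-(γ₂ / 2 * r' ^ 2 * n) + γ₂ / 2 * q) := by
  rw [div_le_iff₀ (Real.exp_pos _), ← Real.exp_add]
  refine hx.trans (Real.exp_le_exp.2 ?_)
  have hn' : (1 : ℝ) ≤ n := by exact_mod_cast hn
  have key : 0 ≤ γ₂ / 2 * (r ^ 2 - r' ^ 2) * ((n : ℝ) - 1) :=
    mul_nonneg (mul_nonneg (by linarith only [hγ₂]) (sub_nonneg.2 hr')) (sub_nonneg.2 hn')
  linarith only [key]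

/-! ## §3. «The box-free centre is b-free» (lens Card T25, Sketch13 §R): radial invariance + holomorphy on the ball force a constant -/

/-- **A holomorphic function on the ball `|b − 1| < ρ` (`ρ ≤ 1`) that is invariant under REAL dilations of its argument
is CONSTANT there**: differentiating `r ↦ f(rb) = f(b)` at `r = 1` gives `b·f′(b) = 0`, `b ≠ 0` on the ball, and a
holomorphic function with zero derivative on a connected open set is constant (Mathlib `IsOpen.is_const_of_deriv_eq_zero`).
No generating function, no several-variable identity theorem (lens Card T25, Sketch13 §R `eq_of_radial_invariant`). [cite: Balaban1987RG1, (2.10)–(2.13) p.266–267] (elementary complex analysis serving the dilated family of (2.10)–(2.13); nothing of the paper asserted) -/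
theorem eq_of_radial_invariant {f : ℂ → ℂ} {ρ : ℝ} (hρ1 : ρ ≤ 1) (hf : DifferentiableOn ℂ f (ball (1 : ℂ) ρ))
    (hrad : ∀ r : ℝ, r ≠ 0 → ∀ b : ℂ, f ((r : ℂ) * b) = f b) :
    ∀ b ∈ ball (1 : ℂ) ρ, f b = f 1 := by
  intro b hb
  have hρ0 : 0 < ρ := lt_of_le_of_lt dist_nonneg (mem_ball.1 hb)
  have hderiv : (ball (1 : ℂ) ρ).EqOn (deriv f) 0 := by
    intro w hw
    have hw1 : ‖w - 1‖ < ρ := by rwa [mem_ball, dist_eq_norm] at hw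
    have hw0 : w ≠ 0 := by
      intro h0
      rw [h0, zero_sub, norm_neg, norm_one] at hw1
      linarith only [hw1, hρ1]
    have hfw : HasDerivAt f (deriv f w) w := (hf.differentiableAt (isOpen_ball.mem_nhds hw)).hasDerivAt
    -- `z ↦ f (z * w)` at `z = 1`, complex then real variable
    have hmul : HasDerivAt (fun z : ℂ => z * w) w 1 := by
      simpa using (hasDerivAt_id (1 : ℂ)).mul_const w
    have hfw' : HasDerivAt f (deriv f w) ((fun z : ℂ => z * w) 1) := by simpa only [one_mul] using hfw
    have hcomp : HasDerivAt (fun z : ℂ => f (z * w)) (deriv f w * w) 1 := hfw'.comp 1 hmul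
    have hcompR : HasDerivAt (fun z : ℂ => f (z * w)) (deriv f w * w) ((1 : ℝ) : ℂ) := by
      rwa [Complex.ofReal_one]
    have hreal : HasDerivAt (fun y : ℝ => f ((y : ℂ) * w)) (deriv f w * w) 1 := hcompR.comp_ofReal
    -- the same real function is CONSTANT near `y = 1` by radial invariance
    have hconst : HasDerivAt (fun y : ℝ => f ((y : ℂ) * w)) 0 1 := by
      refine (hasDerivAt_const (1 : ℝ) (f w)).congr_of_eventuallyEq ?_
      filter_upwards [eventually_ne_nhds (one_ne_zero : (1 : ℝ) ≠ 0)] with y hy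
      exact hrad y hy w
    have h0 : deriv f w * w = 0 := hreal.unique hconst
    rcases mul_eq_zero.1 h0 with h | h
    · simpa using h
    · exact absurd h hw0
  exact isOpen_ball.is_const_of_deriv_eq_zero (convex_ball (1 : ℂ) ρ).isPreconnected hf hderiv hb
    (mem_ball_self hρ0)

/-- **THE CENTRE IS b-FREE at the `X`-integral level**: along the window-dilated family `(b²A(σ), bΓ(σ))` with a
FIELD-CONSTANT last line `c(τ)` (boxes removed, potentials at the background), the `X`-integral of (2.14) does not
depend on `b` on the ball `|b − 1| < ρ_b ≤ 1` — radial invariance is `B13Term214WindowDilated.core214_dilate_family`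
(exact, every complex `b`), holomorphy in `b` is the tree's (module 41 `differentiableOn_…_windowDilated…`, here a
hypothesis; lens Sketch13 §R). [cite: Balaban1987RG1, (2.10)–(2.13) p.266–267; Balaban1988RG2Cluster, (2.14) p.15] -/
theorem core214_windowDilated_const_eq [DecidableEq C₀] {ι D : Type*} (A : (ι → ℂ) → Matrix Λ Λ ℂ)
    (Γ : (ι → ℂ) → (Λ ⊕ C₀ → ℝ) → (Λ → ℂ)) (c : (D → ℂ) → ℂ) {ρb : ℝ} (hρb1 : ρb ≤ 1) (σ : ι → ℂ) (τ : D → ℂ)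
    (hhol : DifferentiableOn ℂ
      (fun b : ℂ => core214 (fun σ => b ^ 2 • A σ) (fun σ X => b • Γ σ X) (fun τ _ => c τ) σ τ) (ball (1 : ℂ) ρb)) :
    ∀ b ∈ ball (1 : ℂ) ρb,
      core214 (fun σ => b ^ 2 • A σ) (fun σ X => b • Γ σ X) (fun τ _ => c τ) σ τ
        = core214 A Γ (fun τ _ => c τ) σ τ := by
  have h := eq_of_radial_invariant hρb1 hhol (fun r hr b => core214_dilate_family A Γ (fun τ _ => c τ) hr b σ τ)
  intro b hb
  rw [h b hb]
  simp only [one_pow, one_smul]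

/-- **THE CENTRE IS b-FREE at the term level** (same, after the printed Cauchy operators; radial invariance
`term214_dilate_family`, holomorphy of the term in `b` from module 41 as a hypothesis; lens Sketch13 §R). [cite: Balaban1987RG1, (2.10)–(2.13) p.266–267; Balaban1988RG2Cluster, (2.14) p.15] -/
theorem term214_windowDilated_const_eq [DecidableEq C₀] {ι D : Type*} [DecidableEq ι] [DecidableEq D] (rr : ℝ)
    (lZ : List ι) (lD : List D) (A : (ι → ℂ) → Matrix Λ Λ ℂ) (Γ : (ι → ℂ) → (Λ ⊕ C₀ → ℝ) → (Λ → ℂ))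
    (c : (D → ℂ) → ℂ) {ρb : ℝ} (hρb1 : ρb ≤ 1) (σ₀ : ι → ℂ) (τ₀ : D → ℂ)
    (hhol : DifferentiableOn ℂ (fun b : ℂ =>
      term214 rr lZ lD (core214 (fun σ => b ^ 2 • A σ) (fun σ X => b • Γ σ X) (fun τ _ => c τ)) σ₀ τ₀) (ball (1 : ℂ) ρb)) :
    ∀ b ∈ ball (1 : ℂ) ρb,
      term214 rr lZ lD (core214 (fun σ => b ^ 2 • A σ) (fun σ X => b • Γ σ X) (fun τ _ => c τ)) σ₀ τ₀
        = term214 rr lZ lD (core214 A Γ (fun τ _ => c τ)) σ₀ τ₀ := by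
  have h := eq_of_radial_invariant hρb1 hhol
    (fun r hr b => term214_dilate_family rr lZ lD A Γ (fun τ _ => c τ) hr b σ₀ τ₀)
  intro b hb
  rw [h b hb]
  simp only [one_pow, one_smul]

/-! ## §4. The assembly shape of (S-vertex-T′) (lens Card T23, Sketch13 §S): three pieces, summed over terms, `s = Re u` -/

/-- **Three pieces**: centred piece `‖m − c₁‖ ≤ s²E₁W` (module 42), box tail `‖c₁ − c_b‖ ≤ s²E₂W` (§T + the capstone),
b-free centre `c_b = v` (§3) ⇒ `‖m − v‖ ≤ s²(E₁ + E₂)W` (lens Card T23, Sketch13 §S). [cite: Balaban1987RG1, (2.13) p.268] (elementary) -/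
theorem centred_three_pieces {m c₁ cb v : ℂ} {s W E₁ E₂ : ℝ} (h1 : ‖m - c₁‖ ≤ s ^ 2 * E₁ * W)
    (h2 : ‖c₁ - cb‖ ≤ s ^ 2 * E₂ * W) (h3 : cb = v) : ‖m - v‖ ≤ s ^ 2 * (E₁ + E₂) * W := by
  have e : m - v = (m - c₁) + (c₁ - cb) := by rw [← h3]; ring
  rw [e]
  refine (norm_add_le _ _).trans ?_
  calc ‖m - c₁‖ + ‖c₁ - cb‖ ≤ s ^ 2 * E₁ * W + s ^ 2 * E₂ * W := add_le_add h1 h2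
    _ = s ^ 2 * (E₁ + E₂) * W := by ring

/-- Summation over the (finitely many, on a finite torus) terms: `TFc := Σ m_t`, `V := Σ v_t` (lens Sketch13 §S). [cite: Balaban1988RG2Cluster, (2.14) p.15] (elementary) -/
theorem centred_sum {T : Type*} (S : Finset T) (m v : T → ℂ) {s : ℝ} (E : T → ℝ)
    (h : ∀ t ∈ S, ‖m t - v t‖ ≤ s ^ 2 * E t) :
    ‖∑ t ∈ S, m t - ∑ t ∈ S, v t‖ ≤ s ^ 2 * ∑ t ∈ S, E t := by
  rw [← Finset.sum_sub_distrib, Finset.mul_sum]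
  exact (norm_sum_le _ _).trans (Finset.sum_le_sum h)

/-- **The consumer's shape** (lens Sketch13 §S): a bound `≤ (Re u)²·E·W` is a bound `≤ Mv·‖u‖²·W` with `Mv := E` — the base point `s = Re u` turns `s²` into node N22's `‖u‖²`. [cite: Balaban1987RG1, (2.13) p.268] (elementary) -/
theorem consumer_shape {T E W : ℝ} (u : ℂ) (hE : 0 ≤ E) (hW : 0 ≤ W) (h : T ≤ u.re ^ 2 * E * W) :
    T ≤ E * ‖u‖ ^ 2 * W := by
  refine h.trans ?_
  -- `(Re u)² ≤ |u|²` (the tree's `…KleinGordonSuperradiantInstabilityProofs.re_sq_le_norm_sq`, inlined)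
  have hre : u.re ^ 2 ≤ ‖u‖ ^ 2 := by
    rw [Complex.sq_norm, Complex.normSq_apply]; nlinarith only [sq_nonneg u.im]
  have h2 := mul_le_mul_of_nonneg_right hre (mul_nonneg hE hW)
  linarith only [h2]

/-! ## §5. The F-generic centred (2.23)∕(2.26) (lens rider P⁵, Sketch13 §E): one lemma for the centred piece, the box tail
and the large-field terms — every integrability side condition discharged from the letters -/

section Generic

variable [DecidableEq C₀] {A : Matrix Λ Λ ℂ} {C : Matrix Λ Λ ℝ}

/-- **THE CENTRED (2.15) ⇒ (2.23), F-GENERIC, NO integrability side condition**: complex symmetric precision `A` with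
`Re A ≻ 0`, continuous ODD source `Γ`, strongly measurable last lines `F, F₀` and an ODD `ℓ` with the common Gaussian growth
`K₁e^{½a‖B‖²}`, the centred remainder `‖F − F₀ − ℓ‖ ≤ Ke^{½a‖B‖²}`, and the replacement letters of pp. 15–17 at
`α₅ = 2ρ + a`: `‖∫dμ₀(X)(lines 2–3)(F) − ∫dμ₀(X)(lines 2–3)(F₀)‖ ≤ e^{2η|Λ|}·K·integral223 C Γ₀ α₅` — the `X`-integral of
print's (2.15)∕(2.23) for the majorant OF THE CENTRED REMAINDER (dag-n10-c `norm_core214_sub_le_215_centred` ∘ tree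
`replaced_le_integral223`; the six linearity conditions by `integrable_inner∕outer_of_letters`, the two (2.15) ones by
`integrable_hg215_gauss` ∕ `integrable_hX215_gauss`).  The uncentred `norm_core214_le_223_of_continuous` is the pattern (lens rider P⁵, Sketch13 §E).
[cite: Balaban1988RG2Cluster, (2.14)–(2.15) p.15, (2.16)–(2.22) p.16, (2.23)–(2.25) p.17; Balaban1987RG1, (2.13) p.268] -/
theorem norm_core214_centred_le_223_of_letters (hAs : A.IsSymm) (hA : (A.map Complex.re).PosDef)
    {Γ : (Λ ⊕ C₀ → ℝ) → (Λ → ℂ)} (hΓc : Continuous Γ) (hΓodd : ∀ X, Γ (-X) = -Γ X) (F F₀ ℓ : (Λ → ℝ) → ℂ)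
    (hFm : StronglyMeasurable F) (hF₀m : StronglyMeasurable F₀) (hℓm : StronglyMeasurable ℓ)
    (hℓodd : ∀ B, ℓ (-B) = -ℓ B) (hC : C.PosDef) (Γ₀ : Matrix Λ (Λ ⊕ C₀) ℝ) {ρ η a K₁ K c g : ℝ}
    (hρ0 : 0 ≤ ρ) (ha0 : 0 ≤ a) (hK₁ : 0 ≤ K₁) (hK : 0 ≤ K)
    (hR1 : ∀ X : Λ ⊕ C₀ → ℝ, -(1 / 2) * ((Γ X) ⬝ᵥ (A⁻¹ *ᵥ Γ X)).re
      ≤ -(1 / 2 * ((Γ₀ *ᵥ X) ⬝ᵥ (C *ᵥ (Γ₀ *ᵥ X)))) + ρ / 2 * (X ⬝ᵥ X))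
    (h17a : Real.sqrt (‖A.det‖ / (A.map Complex.re).det) ≤ Real.exp (η * Fintype.card Λ))
    (h17b : Real.sqrt ((A.map Complex.re).det / C⁻¹.det) ≤ Real.exp (η * Fintype.card Λ))
    (hR2 : ∀ B : Λ → ℝ, B ⬝ᵥ ((C⁻¹ - A.map Complex.re) *ᵥ B) ≤ ρ * (B ⬝ᵥ B))
    (hR3 : ∀ (X : Λ ⊕ C₀ → ℝ) (B : Λ → ℝ), -(B ⬝ᵥ fun i => (Γ X i).re)
      ≤ -(B ⬝ᵥ (Γ₀ *ᵥ X)) + ρ / 2 * (X ⬝ᵥ X + B ⬝ᵥ B))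
    (hF : ∀ B, ‖F B‖ ≤ K₁ * Real.exp (a / 2 * (B ⬝ᵥ B))) (hF₀ : ∀ B, ‖F₀ B‖ ≤ K₁ * Real.exp (a / 2 * (B ⬝ᵥ B)))
    (hℓ : ∀ B, ‖ℓ B‖ ≤ K₁ * Real.exp (a / 2 * (B ⬝ᵥ B)))
    (hrem : ∀ B, ‖F B - F₀ B - ℓ B‖ ≤ K * Real.exp (a / 2 * (B ⬝ᵥ B)))
    (hc0 : 0 ≤ c) (hc : ∀ k, hC.1.eigenvalues k ≤ c) (hαc : (2 * ρ + a) * c ≤ 1 / 2)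
    (hΓq : ∀ X : Λ ⊕ C₀ → ℝ, (Γ₀ *ᵥ X) ⬝ᵥ (C *ᵥ (Γ₀ *ᵥ X)) ≤ g * (X ⬝ᵥ X))
    (hsmall : (2 * ρ + a) * (1 + 2 * c * g) < 1) :
    ‖cgaussMean (1 : Matrix (Λ ⊕ C₀) (Λ ⊕ C₀) ℂ) (fun X => integrand214 A Γ F X)
        - cgaussMean (1 : Matrix (Λ ⊕ C₀) (Λ ⊕ C₀) ℂ) (fun X => integrand214 A Γ F₀ X)‖
      ≤ Real.exp (2 * η * Fintype.card Λ) * K * integral223 C Γ₀ (2 * ρ + a) := by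
  have hsm : (2 * ρ + a) * c < 1 := lt_of_le_of_lt hαc (by norm_num)
  have hρac : (ρ + a) * c < 1 := by linarith only [hsm, mul_nonneg hρ0 hc0]
  have hα : (C⁻¹ - (2 * ρ + a) • (1 : Matrix Λ Λ ℝ)).PosDef := posDef_inv_sub_smul hC hc hsm
  have hIF := fun X => integrable_inner_of_letters hC hα hR2 hR3 hF hFm X
  have hIF₀ := fun X => integrable_inner_of_letters hC hα hR2 hR3 hF₀ hF₀m X
  have hIℓ := fun X => integrable_inner_of_letters hC hα hR2 hR3 hℓ hℓm X
  have hOF := integrable_outer_of_letters hAs hA hΓc hFm hC Γ₀ hρ0 ha0 hK₁ hR1 h17a h17b hR2 hR3 hF hc0 hc hαc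
    hΓq hsmall
  have hOF₀ := integrable_outer_of_letters hAs hA hΓc hF₀m hC Γ₀ hρ0 ha0 hK₁ hR1 h17a h17b hR2 hR3 hF₀ hc0 hc hαc
    hΓq hsmall
  have hOℓ := integrable_outer_of_letters hAs hA hΓc hℓm hC Γ₀ hρ0 ha0 hK₁ hR1 h17a h17b hR2 hR3 hℓ hc0 hc hαc
    hΓq hsmall
  have hg := fun X => integrable_hg215_gauss (A := A) hC K hR2 hc hρac (Γ X)
  have hX := integrable_hX215_gauss hA hC hΓc Γ₀ hρ0 ha0 hK hR1 h17a h17b hR2 hR3 hc0 hc hαc hΓq hsmall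
  refine (norm_core214_sub_le_215_centred hAs hA hΓodd F F₀ ℓ hℓodd (fun B => K * Real.exp (a / 2 * (B ⬝ᵥ B)))
    hrem hIF hIF₀ hIℓ hOF hOF₀ hOℓ hg hX).trans ?_
  exact replaced_le_integral223 hA hC Γ Γ₀ hρ0 ha0 hK hR1 h17a h17b hR2 hR3
    (fun B => K * Real.exp (a / 2 * (B ⬝ᵥ B))) (fun B => by positivity) (fun B => le_rfl) hc0 hc hαc hΓq hsmall

/-- **… ⇒ (2.26)**: the same with `B13Integral223.integral223_le` inserted (`α₅c ≤ ½`, `α₅(1 + 2cg) ≤ ½`):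
`≤ e^{2η|Λ|}·K·e^{α₅c|Λ|}·e^{α₅(1+2cg)|Λ⊕C₀|}`, `α₅ = 2ρ + a`.  This is the SHAPE rider P⁵ offers for dag-n10-c's part-2
pointwise lemma: F-generic, hence serving the centred piece, the box tail (`ℓ := 0`) and the large-field terms at once (lens Sketch13 §E).
[cite: Balaban1988RG2Cluster, (2.14)–(2.15) p.15, (2.23)–(2.26) p.17] -/
theorem norm_core214_centred_le_226_of_letters (hAs : A.IsSymm) (hA : (A.map Complex.re).PosDef)
    {Γ : (Λ ⊕ C₀ → ℝ) → (Λ → ℂ)} (hΓc : Continuous Γ) (hΓodd : ∀ X, Γ (-X) = -Γ X) (F F₀ ℓ : (Λ → ℝ) → ℂ)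
    (hFm : StronglyMeasurable F) (hF₀m : StronglyMeasurable F₀) (hℓm : StronglyMeasurable ℓ)
    (hℓodd : ∀ B, ℓ (-B) = -ℓ B) (hC : C.PosDef) (Γ₀ : Matrix Λ (Λ ⊕ C₀) ℝ) {ρ η a K₁ K c g : ℝ}
    (hρ0 : 0 ≤ ρ) (ha0 : 0 ≤ a) (hK₁ : 0 ≤ K₁) (hK : 0 ≤ K)
    (hR1 : ∀ X : Λ ⊕ C₀ → ℝ, -(1 / 2) * ((Γ X) ⬝ᵥ (A⁻¹ *ᵥ Γ X)).re
      ≤ -(1 / 2 * ((Γ₀ *ᵥ X) ⬝ᵥ (C *ᵥ (Γ₀ *ᵥ X)))) + ρ / 2 * (X ⬝ᵥ X))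
    (h17a : Real.sqrt (‖A.det‖ / (A.map Complex.re).det) ≤ Real.exp (η * Fintype.card Λ))
    (h17b : Real.sqrt ((A.map Complex.re).det / C⁻¹.det) ≤ Real.exp (η * Fintype.card Λ))
    (hR2 : ∀ B : Λ → ℝ, B ⬝ᵥ ((C⁻¹ - A.map Complex.re) *ᵥ B) ≤ ρ * (B ⬝ᵥ B))
    (hR3 : ∀ (X : Λ ⊕ C₀ → ℝ) (B : Λ → ℝ), -(B ⬝ᵥ fun i => (Γ X i).re)
      ≤ -(B ⬝ᵥ (Γ₀ *ᵥ X)) + ρ / 2 * (X ⬝ᵥ X + B ⬝ᵥ B))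
    (hF : ∀ B, ‖F B‖ ≤ K₁ * Real.exp (a / 2 * (B ⬝ᵥ B))) (hF₀ : ∀ B, ‖F₀ B‖ ≤ K₁ * Real.exp (a / 2 * (B ⬝ᵥ B)))
    (hℓ : ∀ B, ‖ℓ B‖ ≤ K₁ * Real.exp (a / 2 * (B ⬝ᵥ B)))
    (hrem : ∀ B, ‖F B - F₀ B - ℓ B‖ ≤ K * Real.exp (a / 2 * (B ⬝ᵥ B)))
    (hc0 : 0 ≤ c) (hc : ∀ k, hC.1.eigenvalues k ≤ c) (hαc : (2 * ρ + a) * c ≤ 1 / 2) (hg0 : 0 ≤ g)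
    (hΓq : ∀ X : Λ ⊕ C₀ → ℝ, (Γ₀ *ᵥ X) ⬝ᵥ (C *ᵥ (Γ₀ *ᵥ X)) ≤ g * (X ⬝ᵥ X))
    (hsmall : (2 * ρ + a) * (1 + 2 * c * g) ≤ 1 / 2) :
    ‖cgaussMean (1 : Matrix (Λ ⊕ C₀) (Λ ⊕ C₀) ℂ) (fun X => integrand214 A Γ F X)
        - cgaussMean (1 : Matrix (Λ ⊕ C₀) (Λ ⊕ C₀) ℂ) (fun X => integrand214 A Γ F₀ X)‖
      ≤ Real.exp (2 * η * Fintype.card Λ) * K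
        * (Real.exp ((2 * ρ + a) * c * Fintype.card Λ)
          * Real.exp ((2 * ρ + a) * (1 + 2 * c * g) * Fintype.card (Λ ⊕ C₀))) :=
  (norm_core214_centred_le_223_of_letters hAs hA hΓc hΓodd F F₀ ℓ hFm hF₀m hℓm hℓodd hC Γ₀ hρ0 ha0 hK₁ hK hR1 h17a
      h17b hR2 hR3 hF hF₀ hℓ hrem hc0 hc hαc hΓq (lt_of_le_of_lt hsmall (by norm_num))).trans
    (mul_le_mul_of_nonneg_left (integral223_le hC Γ₀ (by linarith only [hρ0, ha0]) hc0 hc hαc hg0 hΓq hsmall)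
      (mul_nonneg (Real.exp_pos _).le hK))

/-- **THE BOX TAIL IS THE SAME LEMMA WITH `ℓ := 0`** (Card T24 at the `X`-integral level): removing the boxes from the
printed last line costs `‖core(F214(χ,χᶜ,𝐕₀)) − core(F214(1,1,𝐕₀))‖ ≤ e^{2η|Λ|}·e^{−½κR²}e^{w₀}·integral223 C Γ₀ (2ρ+κ+a₀)`
whenever `0 ≤ χχᶜ ≤ 1`, `χχᶜ = 1` on `⟨B,B⟩ < R²` and `Σ|τ||𝐕₀| ≤ ½a₀‖B‖² + w₀` — with `R = p(s)/s` the constant is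
`O(s²)` (`boxTail_rate`).  No new engine (lens Card T24, Sketch13 §E). [cite: Balaban1988RG2Cluster, (2.14)–(2.15) p.15, (2.20)–(2.22) p.16, (2.23) p.17] -/
theorem norm_core214_boxTail_le_223_of_letters {D : Type*} (hAs : A.IsSymm) (hA : (A.map Complex.re).PosDef)
    {Γ : (Λ ⊕ C₀ → ℝ) → (Λ → ℂ)} (hΓc : Continuous Γ) (hΓodd : ∀ X, Γ (-X) = -Γ X) (cardP : ℕ)
    {χY₀ χcP : (Λ → ℝ) → ℝ} (hχm : Measurable χY₀) (hχcm : Measurable χcP) (hχ0 : ∀ B, 0 ≤ χY₀ B)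
    (hχc0 : ∀ B, 0 ≤ χcP B) (hχ1 : ∀ B, χY₀ B * χcP B ≤ 1) {R κ : ℝ} (hκ : 0 ≤ κ)
    (hbox : ∀ B, B ⬝ᵥ B < R ^ 2 → χY₀ B * χcP B = 1) (Dfam : Finset D) {V₀ : D → (Λ → ℝ) → ℂ}
    (hV₀m : ∀ Y, Measurable (V₀ Y)) (τ : D → ℂ) {a₀ w₀ : ℝ} (ha₀ : 0 ≤ a₀)
    (h220 : ∀ B, ∑ Y ∈ Dfam, ‖τ Y‖ * ‖V₀ Y B‖ ≤ a₀ / 2 * (B ⬝ᵥ B) + w₀)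
    (hC : C.PosDef) (Γ₀ : Matrix Λ (Λ ⊕ C₀) ℝ) {ρ η c g : ℝ} (hρ0 : 0 ≤ ρ)
    (hR1 : ∀ X : Λ ⊕ C₀ → ℝ, -(1 / 2) * ((Γ X) ⬝ᵥ (A⁻¹ *ᵥ Γ X)).re
      ≤ -(1 / 2 * ((Γ₀ *ᵥ X) ⬝ᵥ (C *ᵥ (Γ₀ *ᵥ X)))) + ρ / 2 * (X ⬝ᵥ X))
    (h17a : Real.sqrt (‖A.det‖ / (A.map Complex.re).det) ≤ Real.exp (η * Fintype.card Λ))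
    (h17b : Real.sqrt ((A.map Complex.re).det / C⁻¹.det) ≤ Real.exp (η * Fintype.card Λ))
    (hR2 : ∀ B : Λ → ℝ, B ⬝ᵥ ((C⁻¹ - A.map Complex.re) *ᵥ B) ≤ ρ * (B ⬝ᵥ B))
    (hR3 : ∀ (X : Λ ⊕ C₀ → ℝ) (B : Λ → ℝ), -(B ⬝ᵥ fun i => (Γ X i).re)
      ≤ -(B ⬝ᵥ (Γ₀ *ᵥ X)) + ρ / 2 * (X ⬝ᵥ X + B ⬝ᵥ B))
    (hc0 : 0 ≤ c) (hc : ∀ k, hC.1.eigenvalues k ≤ c) (hαc : (2 * ρ + (κ + a₀)) * c ≤ 1 / 2)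
    (hΓq : ∀ X : Λ ⊕ C₀ → ℝ, (Γ₀ *ᵥ X) ⬝ᵥ (C *ᵥ (Γ₀ *ᵥ X)) ≤ g * (X ⬝ᵥ X))
    (hsmall : (2 * ρ + (κ + a₀)) * (1 + 2 * c * g) < 1) :
    ‖cgaussMean (1 : Matrix (Λ ⊕ C₀) (Λ ⊕ C₀) ℂ) (fun X => integrand214 A Γ (F214 cardP χY₀ χcP Dfam V₀ τ) X)
        - cgaussMean (1 : Matrix (Λ ⊕ C₀) (Λ ⊕ C₀) ℂ)
            (fun X => integrand214 A Γ (F214 cardP (fun _ => 1) (fun _ => 1) Dfam V₀ τ) X)‖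
      ≤ Real.exp (2 * η * Fintype.card Λ) * (Real.exp (-(κ / 2 * R ^ 2)) * Real.exp w₀)
        * integral223 C Γ₀ (2 * ρ + (κ + a₀)) := by
  have hBB : ∀ B : Λ → ℝ, 0 ≤ B ⬝ᵥ B := fun B => Finset.sum_nonneg fun i _ => mul_self_nonneg (B i)
  -- growth of the printed last lines at the rate `κ + a₀` with constant `e^{w₀}` (`χχᶜ ≤ 1`)
  have hgrow : ∀ (χ χc : (Λ → ℝ) → ℝ), (∀ B, 0 ≤ χ B) → (∀ B, 0 ≤ χc B) → (∀ B, χ B * χc B ≤ 1) →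
      ∀ B, ‖F214 cardP χ χc Dfam V₀ τ B‖ ≤ Real.exp w₀ * Real.exp ((κ + a₀) / 2 * (B ⬝ᵥ B)) := by
    intro χ χc h0 hc0' h1 B
    refine (norm_F214_le_printed cardP χ χc Dfam V₀ τ B (h0 B) (hc0' B)).trans ?_
    have e1 : Real.exp (∑ Y ∈ Dfam, ‖τ Y‖ * ‖V₀ Y B‖) ≤ Real.exp w₀ * Real.exp ((κ + a₀) / 2 * (B ⬝ᵥ B)) := by
      rw [← Real.exp_add]
      refine Real.exp_le_exp.2 ((h220 B).trans ?_)
      linarith only [mul_nonneg hκ (hBB B)]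
    calc χ B * χc B * Real.exp (∑ Y ∈ Dfam, ‖τ Y‖ * ‖V₀ Y B‖)
        ≤ 1 * (Real.exp w₀ * Real.exp ((κ + a₀) / 2 * (B ⬝ᵥ B))) :=
          mul_le_mul (h1 B) e1 (Real.exp_pos _).le zero_le_one
      _ = _ := one_mul _
  have hF := hgrow χY₀ χcP hχ0 hχc0 hχ1
  have hF₀ := hgrow (fun _ => 1) (fun _ => 1) (fun _ => zero_le_one) (fun _ => zero_le_one)
    (fun _ => by norm_num)
  have hℓ : ∀ B : Λ → ℝ, ‖(fun _ : Λ → ℝ => (0 : ℂ)) B‖ ≤ Real.exp w₀ * Real.exp ((κ + a₀) / 2 * (B ⬝ᵥ B)) :=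
    fun B => by simp only [norm_zero]; positivity
  -- the remainder `F − F₀ − 0 = −F214(1 − χχᶜ, 1, 𝐕₀)` priced by the box law (§T)
  have hrem : ∀ B, ‖F214 cardP χY₀ χcP Dfam V₀ τ B - F214 cardP (fun _ => 1) (fun _ => 1) Dfam V₀ τ B
        - (fun _ : Λ → ℝ => (0 : ℂ)) B‖
      ≤ (Real.exp (-(κ / 2 * R ^ 2)) * Real.exp w₀) * Real.exp ((κ + a₀) / 2 * (B ⬝ᵥ B)) := by
    intro B
    rw [sub_zero, F214_sub_F214_one, norm_neg]
    refine (norm_F214_le_printed cardP _ _ Dfam V₀ τ B (sub_nonneg.2 (hχ1 B)) zero_le_one).trans ?_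
    have hb := one_sub_box_le_gauss (χ := fun B => χY₀ B * χcP B) hκ (fun B => mul_nonneg (hχ0 B) (hχc0 B)) hbox B
    have e1 : Real.exp (∑ Y ∈ Dfam, ‖τ Y‖ * ‖V₀ Y B‖) ≤ Real.exp (a₀ / 2 * (B ⬝ᵥ B) + w₀) :=
      Real.exp_le_exp.2 (h220 B)
    have e2 : Real.exp (-(κ / 2 * R ^ 2)) * Real.exp (κ / 2 * (B ⬝ᵥ B)) * 1 * Real.exp (a₀ / 2 * (B ⬝ᵥ B) + w₀)
        = (Real.exp (-(κ / 2 * R ^ 2)) * Real.exp w₀) * Real.exp ((κ + a₀) / 2 * (B ⬝ᵥ B)) := by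
      have l1 : Real.exp (-(κ / 2 * R ^ 2)) * Real.exp (κ / 2 * (B ⬝ᵥ B)) * 1 * Real.exp (a₀ / 2 * (B ⬝ᵥ B) + w₀)
          = Real.exp (-(κ / 2 * R ^ 2) + κ / 2 * (B ⬝ᵥ B) + (a₀ / 2 * (B ⬝ᵥ B) + w₀)) := by
        rw [mul_one, ← Real.exp_add, ← Real.exp_add]
      have l2 : (Real.exp (-(κ / 2 * R ^ 2)) * Real.exp w₀) * Real.exp ((κ + a₀) / 2 * (B ⬝ᵥ B))
          = Real.exp (-(κ / 2 * R ^ 2) + w₀ + (κ + a₀) / 2 * (B ⬝ᵥ B)) := by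
        rw [← Real.exp_add, ← Real.exp_add]
      rw [l1, l2]
      congr 1
      ring
    calc (1 - χY₀ B * χcP B) * 1 * Real.exp (∑ Y ∈ Dfam, ‖τ Y‖ * ‖V₀ Y B‖)
        ≤ Real.exp (-(κ / 2 * R ^ 2)) * Real.exp (κ / 2 * (B ⬝ᵥ B)) * 1 * Real.exp (a₀ / 2 * (B ⬝ᵥ B) + w₀) :=
          mul_le_mul (mul_le_mul_of_nonneg_right hb zero_le_one) e1 (Real.exp_pos _).le (by positivity)
      _ = _ := e2
  exact norm_core214_centred_le_223_of_letters hAs hA hΓc hΓodd _ _ (fun _ => (0 : ℂ))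
    (measurable_F214 cardP hχm hχcm Dfam hV₀m τ).stronglyMeasurable
    (measurable_F214 cardP measurable_const measurable_const Dfam hV₀m τ).stronglyMeasurable
    stronglyMeasurable_const (fun B => by simp) hC Γ₀ hρ0 (add_nonneg hκ ha₀) (Real.exp_pos _).le (by positivity)
    hR1 h17a h17b hR2 hR3 hF hF₀ hℓ hrem hc0 hc hαc hΓq hsmall

end Generic

end Literature.MathematicalPhysics.QuantumFieldTheory.Balaban1983to89.B13Term214CentredPieces

end
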